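import Literature.MathematicalPhysics.QuantumFieldTheory.U1DualFluxEnsemble
import Literature.MathematicalPhysics.QuantumFieldTheory.CubicalChainsPairing
import HarnessLib

/-!
# Plaquette fields on a region of `ℤ^d` as 2-chains

Dictionary file of the proof programme of the named fact
`Literature.MathematicalPhysics.QuantumFieldTheory.FrohlichSpencerU1PerimeterLawD4`.
The dual (flux) representation of the free-boundary `U(1)` theory
(`U1DualRepresentation`, `U1DualFluxEnsemble`) is written with *plaquette fields*
`c : plaquettesIn Λ → ℤ` and the integer bond currents `∑ₚ cₚ ∂p : ZdEdge d →₀ ℤ`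
(`plaqCurrent`), whereas the lattice calculus of the programme (`CubicalChainsPoincare`,
`CubicalChainsHodge`, `CubicalChainsPairing`, `U1CoulombSheetEnergy`) is written with alternating
tensors `M : Site d → Fin d → Fin d → A` and the divergence `div₂`. This file identifies the two:

* `plaqChain p` — the elementary 2-chain of the oriented plaquette `p = (x; i, j)`;
  `div₂_plaqChain : div₂ (plaqChain p) y k = plaqCurrent p (y, k)` (the boundary of the
  elementary 2-chain is the plaquette current);
* `fluxChain Λ c = ∑ₚ cₚ · plaqChain p` — the 2-chain of a plaquette field; it is alternating,
  finitely supported, supported on the plaquettes of `Λ`, takes the value `cₚ` on `p`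
  (`fluxChain_apply_of_mem`), and `ofChain` inverts it (`ofChain_fluxChain`,
  `fluxChain_ofChain`);
* `sum_smul_plaqCurrent_apply : (∑ₚ cₚ • plaqCurrent p) (y, k) = div₂ (fluxChain Λ c) y k`, whence
  the closed-flux constraint of `U1DualFluxEnsemble` is `div₂ (fluxChain Λ c) = 0`
  (`sum_smul_plaqCurrent_eq_zero_iff`), also after casting to `ℝ`
  (`div₂_fluxChain_intCast_eq_zero_iff`);
* `pair₂_fluxChain_left : ⟪fluxChain Λ c, M⟫₂ = ∑ₚ cₚ M(p)` for alternating `M`, and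
  `pair₂_fluxChain_fluxChain : ⟪fluxChain Λ c, fluxChain Λ c'⟫₂ = ∑ₚ cₚ c'ₚ` (the pairing `pair₂`
  of `CubicalChainsPairing`, which counts each plaquette once, is the Euclidean inner product of
  plaquette fields).

Everything is proved; no named fact is introduced.

## References

* J. Fröhlich, T. Spencer, Comm. Math. Phys. 83 (1982) 411–454, §2.3 (2.9)–(2.18) (cell complex,
  forms, `(·,·)`), §2.4 (2.19)–(2.31) (the dual model). [FrohlichSpencerCMP1982]
-/

open Finset Function Literature.Probability.LatticeModels
open Literature.Probability.LatticeModels renaming Site → ZdSite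

noncomputable section

namespace Literature.MathematicalPhysics.QuantumFieldTheory

open LatticeForm (e)
open LatticeChain

variable {d : ℕ}

/-! ### The elementary 2-chain of a plaquette -/

section PlaqChain

variable {A : Type*} [CommRing A]

/-- The elementary 2-chain of the oriented plaquette `p = (x; i, j)`: `+1` on `(x; i, j)`, `-1` on
`(x; j, i)`, `0` elsewhere (and `0` if `i = j`). [folklore] -/
def plaqChain (p : Plaq d) : ZdSite d → Fin d → Fin d → A :=
  fun y k l => (if (y, k, l) = p then 1 else 0) - (if (y, l, k) = p then 1 else 0)

/-- `plaqChain` is alternating. [folklore] -/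
theorem plaqChain_swap (p : Plaq d) (y : ZdSite d) (k l : Fin d) :
    (plaqChain p y l k : A) = -plaqChain p y k l := by
  simp only [plaqChain]; abel

/-- The value on the plaquette itself (`i ≠ j`). [folklore] -/
theorem plaqChain_self {p : Plaq d} (hp : p.2.1 ≠ p.2.2) :
    (plaqChain p p.1 p.2.1 p.2.2 : A) = 1 := by
  have h : (p.1, p.2.2, p.2.1) ≠ p := by
    intro h'
    exact hp (congrArg (fun q : Plaq d => q.2.1) h').symm
  simp [plaqChain, h]

/-- `plaqChain p` vanishes off `p` and its reverse. [folklore] -/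
theorem plaqChain_eq_zero {p : Plaq d} {y : ZdSite d} {k l : Fin d} (h : (y, k, l) ≠ p)
    (h' : (y, l, k) ≠ p) : (plaqChain p y k l : A) = 0 := by
  simp [plaqChain, h, h']

/-- `plaqChain p` vanishes away from the base point of `p`. [folklore] -/
theorem plaqChain_eq_zero_of_ne {p : Plaq d} {y : ZdSite d} (h : y ≠ p.1) (k l : Fin d) :
    (plaqChain p y k l : A) = 0 :=
  plaqChain_eq_zero (fun h' => h (congrArg Prod.fst h')) (fun h' => h (congrArg Prod.fst h'))

/-- A sum over the directions of indicators of triples with the summation index in the first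
direction slot collapses. [folklore] -/
theorem sum_ite_triple_eq_fst (f : Fin d → ZdSite d) (k : Fin d) (p : Plaq d) :
    ∑ j, (if (f j, j, k) = p then (1 : A) else 0) = if f p.2.1 = p.1 ∧ k = p.2.2 then 1 else 0 := by
  rw [Finset.sum_eq_single p.2.1]
  · congr 1
    simp only [Prod.ext_iff, true_and]
  · intro j _ hj
    rw [if_neg]
    intro h
    exact hj (congrArg (fun q : Plaq d => q.2.1) h)
  · intro h; exact absurd (Finset.mem_univ _) h

/-- The same with the summation index in the second direction slot. [folklore] -/
theorem sum_ite_triple_eq_snd (f : Fin d → ZdSite d) (k : Fin d) (p : Plaq d) :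
    ∑ j, (if (f j, k, j) = p then (1 : A) else 0) = if f p.2.2 = p.1 ∧ k = p.2.1 then 1 else 0 := by
  rw [Finset.sum_eq_single p.2.2]
  · congr 1
    simp only [Prod.ext_iff, eq_iff_iff]
    tauto
  · intro j _ hj
    rw [if_neg]
    intro h
    exact hj (congrArg (fun q : Plaq d => q.2.2) h)
  · intro h; exact absurd (Finset.mem_univ _) h

/-- **The boundary of the elementary 2-chain, explicitly**:
`div₂ (plaqChain (x;i,j)) (y,k) = [y = x+eᵢ, k = j] - [y = x+eⱼ, k = i] - [y = x, k = j] + [y = x, k = i]`.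
[folklore] -/
theorem div₂_plaqChain_eq (p : Plaq d) (y : ZdSite d) (k : Fin d) :
    div₂ (plaqChain p : ZdSite d → Fin d → Fin d → A) y k =
      (if y = p.1 + e p.2.1 ∧ k = p.2.2 then 1 else 0) - (if y = p.1 + e p.2.2 ∧ k = p.2.1 then 1 else 0)
        - (if y = p.1 ∧ k = p.2.2 then 1 else 0) + (if y = p.1 ∧ k = p.2.1 then 1 else 0) := by
  simp only [div₂, plaqChain, Finset.sum_sub_distrib]
  rw [sum_ite_triple_eq_fst (fun j => y - e j) k p, sum_ite_triple_eq_snd (fun j => y - e j) k p,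
    sum_ite_triple_eq_fst (fun _ => y) k p, sum_ite_triple_eq_snd (fun _ => y) k p]
  simp only [sub_eq_iff_eq_add]
  abel

/-- **The plaquette current, explicitly**:
`plaqCurrent (x;i,j) (y,k) = [y = x, k = i] + [y = x+eᵢ, k = j] - [y = x+eⱼ, k = i] - [y = x, k = j]`.
[folklore] -/
theorem plaqCurrent_apply_eq (p : Plaq d) (y : ZdSite d) (k : Fin d) :
    plaqCurrent p (y, k) =
      (if y = p.1 ∧ k = p.2.1 then 1 else 0) + (if y = p.1 + e p.2.1 ∧ k = p.2.2 then 1 else 0)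
        - (if y = p.1 + e p.2.2 ∧ k = p.2.1 then 1 else 0) - (if y = p.1 ∧ k = p.2.2 then 1 else 0) := by
  simp only [plaqCurrent, Finsupp.coe_sub, Finsupp.coe_add, Pi.sub_apply, Pi.add_apply,
    Finsupp.single_apply, Prod.mk.injEq, e]
  simp only [eq_comm (a := p.1), eq_comm (a := p.2.1), eq_comm (a := p.2.2),
    eq_comm (a := p.1 + Pi.single p.2.1 1), eq_comm (a := p.1 + Pi.single p.2.2 1)]

/-- **The boundary of the elementary 2-chain of `p` is the plaquette current `∂p`**
(`plaqCurrent`, the exponents of the bond variables in the plaquette holonomy). [folklore] -/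
theorem div₂_plaqChain (p : Plaq d) (y : ZdSite d) (k : Fin d) :
    div₂ (plaqChain p : ZdSite d → Fin d → Fin d → A) y k = (plaqCurrent p (y, k) : A) := by
  rw [div₂_plaqChain_eq, plaqCurrent_apply_eq]
  push_cast
  abel

end PlaqChain

/-! ### The 2-chain of a plaquette field -/

section FluxChain

variable {A : Type*} [CommRing A]

/-- **The 2-chain of a plaquette field** `c` on the plaquettes of `Λ`:
`fluxChain Λ c = ∑ₚ cₚ · plaqChain p` (pointwise). [folklore] -/
def fluxChain (Λ : Finset (ZdSite d)) (c : ↥(plaquettesIn Λ) → A) : ZdSite d → Fin d → Fin d → A :=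
  fun y k l => ∑ p, c p * plaqChain (p : Plaq d) y k l

/-- Reading off a plaquette field from a 2-chain: the coefficient of `(x; i, j)`, `i < j`. [folklore] -/
def ofChain (Λ : Finset (ZdSite d)) (M : ZdSite d → Fin d → Fin d → A) : ↥(plaquettesIn Λ) → A :=
  fun p => M (p : Plaq d).1 (p : Plaq d).2.1 (p : Plaq d).2.2

variable {Λ : Finset (ZdSite d)}

/-- A plaquette of `Λ` has distinct directions. [folklore] -/
theorem ne_of_mem_plaquettesIn {p : Plaq d} (hp : p ∈ plaquettesIn Λ) : p.2.1 ≠ p.2.2 :=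
  (Plaq.mem_plaquettesIn.1 hp).2.1.ne

/-- A plaquette of `Λ` and its reverse are never both plaquettes of `Λ`. [folklore] -/
theorem swap_not_mem_plaquettesIn {y : ZdSite d} {k l : Fin d} (h : (y, k, l) ∈ plaquettesIn Λ) :
    (y, l, k) ∉ plaquettesIn Λ := fun h' =>
  lt_asymm (Plaq.mem_plaquettesIn.1 h).2.1 (Plaq.mem_plaquettesIn.1 h').2.1

/-- `fluxChain` is alternating. [folklore] -/
theorem fluxChain_swap (c : ↥(plaquettesIn Λ) → A) (y : ZdSite d) (k l : Fin d) :
    fluxChain Λ c y l k = -fluxChain Λ c y k l := by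
  simp only [fluxChain, ← Finset.sum_neg_distrib, ← mul_neg]
  exact Finset.sum_congr rfl fun p _ => by rw [plaqChain_swap]

/-- The diagonal vanishes. [folklore] -/
theorem fluxChain_diag (c : ↥(plaquettesIn Λ) → A) (y : ZdSite d) (k : Fin d) :
    fluxChain Λ c y k k = 0 := by
  simp [fluxChain, plaqChain]

/-- **The value of `fluxChain Λ c` on a plaquette of `Λ` is `cₚ`.** [folklore] -/
theorem fluxChain_apply_of_mem (c : ↥(plaquettesIn Λ) → A) {y : ZdSite d} {k l : Fin d}
    (h : (y, k, l) ∈ plaquettesIn Λ) : fluxChain Λ c y k l = c ⟨(y, k, l), h⟩ := by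
  unfold fluxChain
  rw [Finset.sum_eq_single ⟨(y, k, l), h⟩]
  · have : (plaqChain ((⟨(y, k, l), h⟩ : ↥(plaquettesIn Λ)) : Plaq d) y k l : A) = 1 :=
      plaqChain_self (p := (y, k, l)) (ne_of_mem_plaquettesIn h)
    rw [this, mul_one]
  · intro p _ hp
    rw [plaqChain_eq_zero, mul_zero]
    · intro h'; exact hp (Subtype.ext h'.symm)
    · intro h'
      have hmem : (y, l, k) ∈ plaquettesIn Λ := by rw [h']; exact p.2
      exact swap_not_mem_plaquettesIn h hmem
  · intro h'; exact absurd (Finset.mem_univ _) h'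

/-- The value on the reverse of a plaquette of `Λ` is `-cₚ`. [folklore] -/
theorem fluxChain_apply_of_mem' (c : ↥(plaquettesIn Λ) → A) {y : ZdSite d} {k l : Fin d}
    (h : (y, l, k) ∈ plaquettesIn Λ) : fluxChain Λ c y k l = -c ⟨(y, l, k), h⟩ := by
  rw [← fluxChain_apply_of_mem c h, ← fluxChain_swap]

/-- `fluxChain Λ c` vanishes on triples which are neither a plaquette of `Λ` nor the reverse of
one. [folklore] -/
theorem fluxChain_apply_eq_zero (c : ↥(plaquettesIn Λ) → A) {y : ZdSite d} {k l : Fin d}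
    (h : (y, k, l) ∉ plaquettesIn Λ) (h' : (y, l, k) ∉ plaquettesIn Λ) : fluxChain Λ c y k l = 0 := by
  unfold fluxChain
  refine Finset.sum_eq_zero fun p _ => ?_
  rw [plaqChain_eq_zero, mul_zero]
  · intro hp; apply h; rw [hp]; exact p.2
  · intro hp; apply h'; rw [hp]; exact p.2

/-- Support: where `fluxChain Λ c` is non-zero, the triple or its reverse is a plaquette of `Λ`.
[folklore] -/
theorem mem_or_mem_of_fluxChain_ne_zero (c : ↥(plaquettesIn Λ) → A) {y : ZdSite d} {k l : Fin d}
    (h : fluxChain Λ c y k l ≠ 0) : (y, k, l) ∈ plaquettesIn Λ ∨ (y, l, k) ∈ plaquettesIn Λ := by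
  by_contra hcon
  push Not at hcon
  exact h (fluxChain_apply_eq_zero c hcon.1 hcon.2)

/-- Support: the base point of a non-zero entry lies in `Λ`. [folklore] -/
theorem mem_of_fluxChain_ne_zero (c : ↥(plaquettesIn Λ) → A) {y : ZdSite d} {k l : Fin d}
    (h : fluxChain Λ c y k l ≠ 0) : y ∈ Λ := by
  rcases mem_or_mem_of_fluxChain_ne_zero c h with h' | h'
  · exact (Plaq.mem_plaquettesIn.1 h').1
  · exact (Plaq.mem_plaquettesIn.1 h').1

/-- `fluxChain Λ c` is finitely supported (its base points lie in `Λ`). [folklore] -/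
theorem hasFiniteSupport_fluxChain (c : ↥(plaquettesIn Λ) → A) : HasFiniteSupport (fluxChain Λ c) := by
  refine (Λ.finite_toSet).subset fun y hy => ?_
  simp only [Function.mem_support, ne_eq] at hy
  simp only [Finset.mem_coe]
  by_contra hcon
  apply hy
  funext k l
  by_contra h0
  exact hcon (mem_of_fluxChain_ne_zero c h0)

/-- `fluxChain` is additive. [folklore] -/
theorem fluxChain_add (c c' : ↥(plaquettesIn Λ) → A) :
    fluxChain Λ (c + c') = fluxChain Λ c + fluxChain Λ c' := by
  funext y k l
  simp only [fluxChain, Pi.add_apply, add_mul, Finset.sum_add_distrib]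

/-- `fluxChain` of the zero field. [folklore] -/
theorem fluxChain_zero : fluxChain Λ (0 : ↥(plaquettesIn Λ) → A) = 0 := by
  funext y k l
  simp [fluxChain]

/-- `fluxChain` is odd. [folklore] -/
theorem fluxChain_neg (c : ↥(plaquettesIn Λ) → A) : fluxChain Λ (-c) = -fluxChain Λ c := by
  funext y k l
  simp only [fluxChain, Pi.neg_apply, neg_mul, Finset.sum_neg_distrib]

/-- `fluxChain` is subtractive. [folklore] -/
theorem fluxChain_sub (c c' : ↥(plaquettesIn Λ) → A) :
    fluxChain Λ (c - c') = fluxChain Λ c - fluxChain Λ c' := by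
  rw [sub_eq_add_neg, fluxChain_add, fluxChain_neg, ← sub_eq_add_neg]

/-- `fluxChain` is homogeneous. [folklore] -/
theorem fluxChain_smul (a : A) (c : ↥(plaquettesIn Λ) → A) :
    fluxChain Λ (a • c) = a • fluxChain Λ c := by
  funext y k l
  simp only [fluxChain, Pi.smul_apply, smul_eq_mul, mul_assoc, Finset.mul_sum]

/-- `fluxChain` commutes with ring homomorphisms of the coefficients. [folklore] -/
theorem fluxChain_map {B : Type*} [CommRing B] (f : A →+* B) (c : ↥(plaquettesIn Λ) → A)
    (y : ZdSite d) (k l : Fin d) : fluxChain Λ (fun p => f (c p)) y k l = f (fluxChain Λ c y k l) := by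
  simp only [fluxChain, map_sum, map_mul, plaqChain, map_sub]
  refine Finset.sum_congr rfl fun p _ => ?_
  congr 2 <;> split_ifs <;> simp

/-- `div₂` commutes with ring homomorphisms of the coefficients. [folklore] -/
theorem div₂_map {B : Type*} [CommRing B] (f : A →+* B) (M : ZdSite d → Fin d → Fin d → A)
    (y : ZdSite d) (k : Fin d) : div₂ (fun z i j => f (M z i j)) y k = f (div₂ M y k) := by
  simp only [div₂, map_sum, map_sub]

/-- Reading off the plaquette field of `fluxChain Λ c` returns `c`. [folklore] -/
theorem ofChain_fluxChain (c : ↥(plaquettesIn Λ) → A) : ofChain Λ (fluxChain Λ c) = c := by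
  funext p
  obtain ⟨⟨y, k, l⟩, hp⟩ := p
  exact fluxChain_apply_of_mem c hp

/-- **An alternating 2-chain supported on the plaquettes of `Λ` is the `fluxChain` of its plaquette
field.** [folklore] -/
theorem fluxChain_ofChain {M : ZdSite d → Fin d → Fin d → A} (halt : ∀ y k l, M y l k = -M y k l)
    (hsupp : ∀ y k l, M y k l ≠ 0 → (y, k, l) ∈ plaquettesIn Λ ∨ (y, l, k) ∈ plaquettesIn Λ) :
    fluxChain Λ (ofChain Λ M) = M := by
  funext y k l
  by_cases h : (y, k, l) ∈ plaquettesIn Λ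
  · rw [fluxChain_apply_of_mem _ h]; rfl
  · by_cases h' : (y, l, k) ∈ plaquettesIn Λ
    · rw [fluxChain_apply_of_mem' _ h']
      show -M y l k = M y k l
      rw [halt y k l, neg_neg]
    · rw [fluxChain_apply_eq_zero _ h h']
      by_contra h0
      rcases hsupp y k l (Ne.symm h0) with h1 | h1
      · exact h h1
      · exact h' h1

/-- **`div₂` of the 2-chain of a plaquette field**: `div₂ (fluxChain Λ c) (y,k) = ∑ₚ cₚ (∂p)(y,k)`.
[folklore] -/
theorem div₂_fluxChain (c : ↥(plaquettesIn Λ) → A) (y : ZdSite d) (k : Fin d) :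
    div₂ (fluxChain Λ c) y k = ∑ p, c p * (plaqCurrent (p : Plaq d) (y, k) : A) := by
  have h : div₂ (fluxChain Λ c) y k = ∑ p, c p * div₂ (plaqChain (p : Plaq d)) y k := by
    simp only [div₂, fluxChain, ← Finset.sum_sub_distrib, ← mul_sub]
    rw [Finset.sum_comm]
    refine Finset.sum_congr rfl fun p _ => ?_
    rw [← Finset.mul_sum]
  rw [h]
  simp only [div₂_plaqChain]

end FluxChain

/-! ### The closed-flux constraint is `div₂ = 0` -/

section Closed

variable {Λ : Finset (ZdSite d)}

/-- **The bond current of a plaquette field is the boundary of its 2-chain**: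
`(∑ₚ cₚ • ∂p) (y, k) = div₂ (fluxChain Λ c) (y, k)`. [folklore] -/
theorem sum_smul_plaqCurrent_apply (c : ↥(plaquettesIn Λ) → ℤ) (y : ZdSite d) (k : Fin d) :
    (∑ p, c p • plaqCurrent (p : Plaq d)) (y, k) = div₂ (fluxChain Λ c) y k := by
  rw [div₂_fluxChain, Finsupp.finsetSum_apply]
  refine Finset.sum_congr rfl fun p _ => ?_
  simp only [Finsupp.smul_apply, smul_eq_mul, Int.cast_id]

/-- **The closed-flux constraint of the dual representation is `∂c = 0` for the 2-chain**:
`∑ₚ cₚ • ∂p = 0 ↔ div₂ (fluxChain Λ c) = 0`. [cite: FrohlichSpencerCMP1982, §2.4 (2.19)–(2.21) (the constraint δn = 0 of the dual model)] -/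
theorem sum_smul_plaqCurrent_eq_zero_iff (c : ↥(plaquettesIn Λ) → ℤ) :
    ∑ p, c p • plaqCurrent (p : Plaq d) = 0 ↔ div₂ (fluxChain Λ c) = 0 := by
  constructor
  · intro h
    funext y k
    rw [← sum_smul_plaqCurrent_apply, h]
    rfl
  · intro h
    ext ⟨y, k⟩
    rw [sum_smul_plaqCurrent_apply, h]
    rfl

/-- The real 2-chain of an integer plaquette field is the cast of its integer 2-chain. [folklore] -/
theorem fluxChain_intCast (c : ↥(plaquettesIn Λ) → ℤ) (y : ZdSite d) (k l : Fin d) :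
    fluxChain Λ (fun p => (c p : ℝ)) y k l = ((fluxChain Λ c y k l : ℤ) : ℝ) :=
  fluxChain_map (Int.castRingHom ℝ) c y k l

/-- `div₂` of the real 2-chain of an integer plaquette field is the cast of the integer one. [folklore] -/
theorem div₂_fluxChain_intCast (c : ↥(plaquettesIn Λ) → ℤ) (y : ZdSite d) (k : Fin d) :
    div₂ (fluxChain Λ (fun p => (c p : ℝ))) y k = ((div₂ (fluxChain Λ c) y k : ℤ) : ℝ) := by
  have h : fluxChain Λ (fun p => (c p : ℝ)) = fun z i j => (Int.castRingHom ℝ) (fluxChain Λ c z i j) := by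
    funext z i j; exact fluxChain_intCast c z i j
  rw [h, div₂_map]
  rfl

/-- **The closed-flux constraint, real form**: the real 2-chain of an integer plaquette field is
closed iff the integer bond current vanishes. [folklore] -/
theorem div₂_fluxChain_intCast_eq_zero_iff (c : ↥(plaquettesIn Λ) → ℤ) :
    div₂ (fluxChain Λ (fun p => (c p : ℝ))) = 0 ↔ ∑ p, c p • plaqCurrent (p : Plaq d) = 0 := by
  rw [sum_smul_plaqCurrent_eq_zero_iff]
  simp only [funext_iff, Pi.zero_apply, div₂_fluxChain_intCast, Int.cast_eq_zero]

end Closed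

/-! ### The pairing of 2-chains of plaquette fields -/

section Pairing

variable {Λ : Finset (ZdSite d)}

/-- The real 2-chain of a plaquette field is alternating (`IsAltR₂`). [folklore] -/
theorem isAltR₂_fluxChain (c : ↥(plaquettesIn Λ) → ℝ) : IsAltR₂ (fluxChain Λ c) :=
  fun y k l => fluxChain_swap c y k l

/-- The integer 2-chain of a plaquette field is alternating (`IsAlt₂`). [folklore] -/
theorem isAlt₂_fluxChain (c : ↥(plaquettesIn Λ) → ℤ) : IsAlt₂ (fluxChain Λ c) :=
  fun y k l => fluxChain_swap c y k l

/-- A double sum over the directions of an indicator of one pair collapses. [folklore] -/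
theorem sum_sum_ite_and_eq (i j : Fin d) (g : Fin d → Fin d → ℝ) :
    ∑ k, ∑ l, (if k = i ∧ l = j then g k l else 0) = g i j := by
  have h : ∀ k, ∑ l, (if k = i ∧ l = j then g k l else 0) = if k = i then g k j else 0 := by
    intro k
    by_cases hk : k = i
    · subst hk
      simp only [true_and, if_true]
      rw [Finset.sum_ite_eq' Finset.univ j (g k), if_pos (Finset.mem_univ _)]
    · simp [hk]
  simp_rw [h]
  rw [Finset.sum_ite_eq' Finset.univ i (fun k => g k j), if_pos (Finset.mem_univ _)]

/-- The plaquette sum of an elementary 2-chain against an alternating tensor: `2 M(p)`. [folklore] -/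
theorem sum_sum_plaqChain_mul {M : ZdSite d → Fin d → Fin d → ℝ} (halt : IsAltR₂ M) (p : Plaq d) :
    ∑ k, ∑ l, (plaqChain p p.1 k l : ℝ) * M p.1 k l = 2 * M p.1 p.2.1 p.2.2 := by
  have hterm : ∀ k l, (plaqChain p p.1 k l : ℝ) * M p.1 k l =
      (if k = p.2.1 ∧ l = p.2.2 then M p.1 k l else 0) -
        (if k = p.2.2 ∧ l = p.2.1 then M p.1 k l else 0) := by
    intro k l
    have h1 : ((p.1, k, l) = p) ↔ (k = p.2.1 ∧ l = p.2.2) := by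
      constructor
      · intro h; exact ⟨congrArg (fun q : Plaq d => q.2.1) h, congrArg (fun q : Plaq d => q.2.2) h⟩
      · rintro ⟨rfl, rfl⟩; rfl
    have h2 : ((p.1, l, k) = p) ↔ (k = p.2.2 ∧ l = p.2.1) := by
      constructor
      · intro h; exact ⟨congrArg (fun q : Plaq d => q.2.2) h, congrArg (fun q : Plaq d => q.2.1) h⟩
      · rintro ⟨rfl, rfl⟩; rfl
    simp only [plaqChain, sub_mul, ite_mul, one_mul, zero_mul, if_congr h1 rfl rfl,
      if_congr h2 rfl rfl]
  simp only [hterm, Finset.sum_sub_distrib, sum_sum_ite_and_eq]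
  rw [halt p.1 p.2.1 p.2.2]
  ring

/-- **The pairing of an elementary 2-chain with an alternating tensor is the tensor's value on the
plaquette.** [folklore] -/
theorem pair₂_plaqChain_left {M : ZdSite d → Fin d → Fin d → ℝ} (halt : IsAltR₂ M) (p : Plaq d) :
    pair₂ (plaqChain p) M = M p.1 p.2.1 p.2.2 := by
  unfold pair₂
  rw [tsum_eq_single p.1]
  · rw [sum_sum_plaqChain_mul halt p]; ring
  · intro y hy
    simp [plaqChain_eq_zero_of_ne hy]

/-- The plaquette sums of `fluxChain Λ c` against a tensor, reorganised by plaquettes. [folklore] -/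
theorem sum_sum_fluxChain_mul (c : ↥(plaquettesIn Λ) → ℝ) (M : ZdSite d → Fin d → Fin d → ℝ)
    (y : ZdSite d) :
    ∑ k, ∑ l, fluxChain Λ c y k l * M y k l =
      ∑ p, c p * ∑ k, ∑ l, (plaqChain (p : Plaq d) y k l : ℝ) * M y k l :=
  calc ∑ k, ∑ l, fluxChain Λ c y k l * M y k l
      = ∑ k, ∑ l, ∑ p, c p * ((plaqChain (p : Plaq d) y k l : ℝ) * M y k l) := by
        simp only [fluxChain, Finset.sum_mul, mul_assoc]
    _ = ∑ k, ∑ p, ∑ l, c p * ((plaqChain (p : Plaq d) y k l : ℝ) * M y k l) :=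
        Finset.sum_congr rfl fun k _ => Finset.sum_comm
    _ = ∑ p, ∑ k, ∑ l, c p * ((plaqChain (p : Plaq d) y k l : ℝ) * M y k l) := Finset.sum_comm
    _ = ∑ p, c p * ∑ k, ∑ l, (plaqChain (p : Plaq d) y k l : ℝ) * M y k l := by
        simp only [Finset.mul_sum]

/-- **The pairing of the 2-chain of a plaquette field with an alternating tensor**:
`⟪fluxChain Λ c, M⟫₂ = ∑ₚ cₚ M(p)`. [cite: FrohlichSpencerCMP1982, §2.3 (2.14) (the scalar product on forms)] -/
theorem pair₂_fluxChain_left (c : ↥(plaquettesIn Λ) → ℝ) {M : ZdSite d → Fin d → Fin d → ℝ}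
    (halt : IsAltR₂ M) :
    pair₂ (fluxChain Λ c) M = ∑ p, c p * M (p : Plaq d).1 (p : Plaq d).2.1 (p : Plaq d).2.2 := by
  have hsum : ∀ p : ↥(plaquettesIn Λ),
      Summable fun y => c p * ∑ k, ∑ l, (plaqChain (p : Plaq d) y k l : ℝ) * M y k l := by
    intro p
    refine summable_of_hasFiniteSupport ((Set.finite_singleton (p : Plaq d).1).subset fun y hy => ?_)
    simp only [Function.mem_support, ne_eq] at hy
    by_contra hne
    exact hy (by simp [plaqChain_eq_zero_of_ne hne])
  calc pair₂ (fluxChain Λ c) M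
      = (1 / 2) * ∑' y, ∑ p, c p * ∑ k, ∑ l, (plaqChain (p : Plaq d) y k l : ℝ) * M y k l := by
        simp only [pair₂, sum_sum_fluxChain_mul]
    _ = (1 / 2) * ∑ p, ∑' y, c p * ∑ k, ∑ l, (plaqChain (p : Plaq d) y k l : ℝ) * M y k l := by
        rw [Summable.tsum_finsetSum fun p _ => hsum p]
    _ = ∑ p, c p * pair₂ (plaqChain (p : Plaq d)) M := by
        rw [Finset.mul_sum]
        refine Finset.sum_congr rfl fun p _ => ?_
        rw [tsum_mul_left, pair₂]
        ring
    _ = ∑ p, c p * M (p : Plaq d).1 (p : Plaq d).2.1 (p : Plaq d).2.2 := by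
        refine Finset.sum_congr rfl fun p _ => ?_
        rw [pair₂_plaqChain_left halt (p : Plaq d)]

/-- **The pairing of two 2-chains of plaquette fields is the Euclidean inner product of the
fields**: `⟪fluxChain Λ c, fluxChain Λ c'⟫₂ = ∑ₚ cₚ c'ₚ`. [cite: FrohlichSpencerCMP1982, §2.3 (2.14)] -/
theorem pair₂_fluxChain_fluxChain (c c' : ↥(plaquettesIn Λ) → ℝ) :
    pair₂ (fluxChain Λ c) (fluxChain Λ c') = ∑ p, c p * c' p := by
  rw [pair₂_fluxChain_left c (isAltR₂_fluxChain c')]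
  refine Finset.sum_congr rfl fun p _ => ?_
  obtain ⟨⟨y, k, l⟩, hp⟩ := p
  rw [fluxChain_apply_of_mem c' hp]

/-- `⟪fluxChain Λ c, fluxChain Λ c⟫₂ = ∑ₚ cₚ²`. [folklore] -/
theorem pair₂_fluxChain_self (c : ↥(plaquettesIn Λ) → ℝ) :
    pair₂ (fluxChain Λ c) (fluxChain Λ c) = ∑ p, c p ^ 2 := by
  rw [pair₂_fluxChain_fluxChain]
  exact Finset.sum_congr rfl fun p _ => by ring

end Pairing

end Literature.MathematicalPhysics.QuantumFieldTheory
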